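import Mathlib
import HarnessLib
import Literature.Probability.MarkovChains.PeskunOrdering
import Literature.Probability.MarkovChains.LpDistance

/-!
# Moderate growth and a local Poincaré inequality imply a Nash inequality (Diaconis–Saloff-Coste 1996, Theorem 5.2; Saloff-Coste 1997, Theorem 3.4.3)

HONEST FRAMING: exact (Metropolis-corrected) sampling algorithms for lattice gauge theory; figures
of merit are autocorrelation/cost numbers at stated couplings and volumes; no continuum-physics claim.

Sources (READ on the hub's materialised texts): P. Diaconis, L. Saloff-Coste, *Nash inequalities
for finite Markov chains*, J. Theoret. Probab. **9** (1996) 459–510 [DiaconisSaloffcoste1996Nash],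
§5.3 THEOREM 5.2 with its proof (p. 497) and REMARK 5.4 (2); L. Saloff-Coste, *Lectures on finite
Markov chains*, LNM 1665 (1997) [Saloffcoste1997], §3.4 DEFINITION 3.4.1 ((M,d)-moderate growth,
local Poincaré inequality) and THEOREM 3.4.3 (first display).  Everything below is PROVED (finite
state space; 0 named facts).

THE STATEMENT (DSC Theorem 5.2).  `X` finite with a probability `π`, `𝓔` a Dirichlet form; if for
some integer `R` there are reals `M, d ≥ 1`, `a > 0` with `V(x,r) ≥ (r+1)^d/M` and `‖f − f_r‖₂² ≤
a r² 𝓔(f,f)` for all `x`, all integers `r ∈ [0,R]` and all `f` (`f_r(x) = V(x,r)⁻¹ Σ_{B(x,r)} fπ`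
the ball average), then **`‖f‖₂^{2+4/d} ≤ C [𝓔(f,f) + (aR²)⁻¹‖f‖₂²] ‖f‖₁^{4/d}`, `C =
(1 + 1/d)²(1 + d)^{2/d} M^{2/d} a`**.  REMARK 5.4 (2): "the volume `V(x,r)` and the mean value `f_r(x)`
do not need to be defined in terms of balls: any family of sets depending on the parameter `r` could
be used instead" — accordingly the theorem is typed for an ARBITRARY family of averaging sets
`B x r : Finset X` (`setAverage`), and its analytic core `DiaconisSaloffcoste1996_thm_5_2` only
consumes the two printed consequences `‖f_r‖_∞ ≤ M(r+1)^{−d}‖f‖₁` and `‖f − f_r‖₂² ≤ a r²𝓔(f,f)` for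
the ONE function `f` at hand, with `𝓔(f,f)` entering as a number `E ≥ 0` (so it applies verbatim to
`E = dirichletForm π P f` of any finite chain, `PeskunOrdering.lean`).  The conclusion has exactly the
shape of the Nash inequality (2.3.3) `NashInequalityT π P C d (aR²)` of `NashInequality.lean` (not
imported).  Saloff-Coste's normalisation (THEOREM 3.4.3: growth `V(x,r) ≥ M⁻¹((r+1)/γ)^d` for
`r ≤ γ` the diameter, `C = (1+1/d)²(1+d)^{2/d}M^{2/d}aγ²`, `T = aγ²`) is the case `M ↦ Mγ^d`, `R = γ`.

## Content
* `setAverage π B r f x = (Σ_{y ∈ B x r} π(y)f(y)) / π(B x r)`; `abs_setAverage_le` (volume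
  `π(B x r) ≥ (r+1)^d/M` ⇒ `|f_r(x)| ≤ M(r+1)^{−d}‖f‖₁`, "`⟨f_r,f⟩ ≤ ‖f_r‖_∞‖f‖₁ ≤ M(r+1)^{−d}‖f‖₁²`").
* `nash_of_two_term_bound` — the minimisation AS PRINTED: `∀ s > 0, ‖f‖₂² ≤ s(a[𝓔 +
  (aR²)⁻¹‖f‖₂²])^{1/2}‖f‖₂ + Ms^{−d}‖f‖₁²` ⇒ the Nash inequality with the constant `C` above.
* **THEOREM 5.2** `DiaconisSaloffcoste1996_thm_5_2` (abstract averages, per Remark 5.4 (2)) and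
  `DiaconisSaloffcoste1996_thm_5_2_sets` (averages over an arbitrary family of sets with the volume
  bound); **THEOREM 3.4.3 (first display)** `Saloffcoste1997_thm_3_4_3_nash` for a finite chain `(K,π)`
  with `(M,d)`-moderate growth and a local Poincaré inequality w.r.t. any such family (`𝓔 =
  dirichletForm π P`).

NOT HERE (scope, value-free): the rest of THEOREM 3.4.3 / DSC THEOREM 5.1–5.3 (`λ ≥ 1/(aγ²)`, the
decay `‖h_t^x − 1‖₂ ≤ Be^{−c}` for `t = aγ²(1+c)`, the log-Sobolev bound, the two-sided reversible
estimate) — they combine this file with `NashInequality.lean` (THEOREM 2.3.4 / COROLLARY 2.3.5);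
LEMMA 3.4.2 / DSC LEMMA 5.1 (local Poincaré from paths); the adapted-edge-set metric itself (the
family `B` is a parameter here).

Context (cell pub-lqcd, venture LatticeQCDFlow; value-free): this is the published mechanism behind
"diameter-squared" mixing for local chains of polynomial volume growth — the Nash constant scales
like `aγ²`, so the `L²` mixing time is of order `γ²` up to `M, d, a`.
-/

namespace Literature.Probability.MarkovChains

open Finset Matrix

variable {X : Type*} [Fintype X] {π : X → ℝ}

/-! ## Averages over a family of sets and the `‖f_r‖_∞` bound -/

section Averages

/-- The `π`-average of `f` over the set `B x r`: `f_r(x) = π(B(x,r))⁻¹ Σ_{y ∈ B(x,r)} f(y)π(y)`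
(balls of an adapted edge set in the sources; any family of sets by REMARK 5.4 (2)).
[cite: Saloffcoste1997, §3.4 Definition 3.4.1 (2); DiaconisSaloffcoste1996Nash, §5.3 Remark 5.4 (2)] -/
noncomputable def setAverage (π : X → ℝ) (B : X → ℕ → Finset X) (r : ℕ) (f : X → ℝ) (x : X) : ℝ :=
  (∑ y ∈ B x r, π y * f y) / ∑ y ∈ B x r, π y

/-- **`‖f_r‖_∞ ≤ M(r+1)^{−d}‖f‖₁`** under the volume bound `V(x,r) = π(B(x,r)) ≥ (r+1)^d/M`
("`⟨f_r, f⟩ ≤ ‖f_r‖_∞‖f‖₁ ≤ M(r+1)^{−d}‖f‖₁²`"). [cite: DiaconisSaloffcoste1996Nash, §5.3 proof of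
Theorem 5.2] -/
theorem abs_setAverage_le (hπ0 : ∀ y, 0 ≤ π y) {B : X → ℕ → Finset X} {M d : ℝ} (hM : 0 < M)
    {r : ℕ} {x : X} (hV : ((r : ℝ) + 1) ^ d / M ≤ ∑ y ∈ B x r, π y) (f : X → ℝ) :
    |setAverage π B r f x| ≤ M * ((r : ℝ) + 1) ^ (-d) * ∑ y, π y * |f y| := by
  have hr1 : 0 < (r : ℝ) + 1 := by positivity
  have hpow : 0 < ((r : ℝ) + 1) ^ d := Real.rpow_pos_of_pos hr1 d
  have hVpos : 0 < ∑ y ∈ B x r, π y := lt_of_lt_of_le (div_pos hpow hM) hV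
  unfold setAverage
  rw [abs_div, abs_of_pos hVpos, div_le_iff₀ hVpos]
  have hnum : |∑ y ∈ B x r, π y * f y| ≤ ∑ y, π y * |f y| :=
    (abs_sum_le_sum_abs _ _).trans
      ((sum_le_univ_sum_of_nonneg fun y => abs_nonneg _).trans
        (le_of_eq (sum_congr rfl fun y _ => by rw [abs_mul, abs_of_nonneg (hπ0 y)])))
  have hL0 : 0 ≤ ∑ y, π y * |f y| := sum_nonneg fun y _ => mul_nonneg (hπ0 y) (abs_nonneg _)
  -- `‖f‖₁ ≤ M(r+1)^{−d}‖f‖₁ · V(x,r)` since `M(r+1)^{−d}V(x,r) ≥ 1`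
  have hMV : 1 ≤ M * ((r : ℝ) + 1) ^ (-d) * ∑ y ∈ B x r, π y := by
    rw [Real.rpow_neg hr1.le, mul_assoc]
    have h := mul_le_mul_of_nonneg_left hV (le_of_lt (mul_pos hM (inv_pos.2 hpow)))
    rw [show M * (((r : ℝ) + 1) ^ d)⁻¹ * (((r : ℝ) + 1) ^ d / M) = 1 by field_simp] at h
    simpa [mul_assoc] using h
  calc |∑ y ∈ B x r, π y * f y| ≤ ∑ y, π y * |f y| := hnum
    _ = (∑ y, π y * |f y|) * 1 := (mul_one _).symm
    _ ≤ (∑ y, π y * |f y|) * (M * ((r : ℝ) + 1) ^ (-d) * ∑ y ∈ B x r, π y) :=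
        mul_le_mul_of_nonneg_left hMV hL0
    _ = M * ((r : ℝ) + 1) ^ (-d) * (∑ y, π y * |f y|) * ∑ y ∈ B x r, π y := by ring

end Averages

/-! ## The minimisation step -/

section Minimisation

/-- **The minimisation AS PRINTED (proof of THEOREM 5.2):** if `A = ‖f‖₂² ≥ 0`, `L = ‖f‖₁ ≥ 0`,
`G = 𝓔(f,f) + (aR²)⁻¹‖f‖₂² ≥ 0` and, for all reals `s > 0`, **`A ≤ s·(aGA)^{1/2} + M s^{−d} L²`**,
then **`A^{1+2/d} ≤ (1 + 1/d)²(1 + d)^{2/d}M^{2/d} a G L^{4/d}`** ("Minimizing the right-hand side in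
`s` … The result now follows from routine simplifications"; the minimiser is `s = (dML²/(aGA)^{1/2})
^{1/(d+1)}`). [cite: DiaconisSaloffcoste1996Nash, §5.3 proof of Theorem 5.2] -/
theorem nash_of_two_term_bound {A L G a M d : ℝ} (hA : 0 ≤ A) (hL : 0 ≤ L) (hG : 0 ≤ G)
    (ha : 0 < a) (hM : 0 < M) (hd : 1 ≤ d)
    (h : ∀ s : ℝ, 0 < s → A ≤ s * Real.sqrt (a * G * A) + M * L ^ 2 * s ^ (-d)) :
    A ^ (1 + 2 / d) ≤ (1 + 1 / d) ^ 2 * (1 + d) ^ (2 / d) * M ^ (2 / d) * a * G * L ^ (4 / d) := by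
  have hd0 : 0 < d := by linarith
  rcases hA.eq_or_lt with hA0 | hA0
  · -- `A = 0`
    rw [← hA0, Real.zero_rpow (by positivity)]
    have : 0 ≤ (1 + 1 / d) ^ 2 * (1 + d) ^ (2 / d) * M ^ (2 / d) * a * G := by positivity
    exact mul_nonneg this (Real.rpow_nonneg hL _)
  set B := Real.sqrt (a * G * A) with hB
  set D := M * L ^ 2 with hD
  have hB0 : 0 ≤ B := Real.sqrt_nonneg _
  have hD0 : 0 ≤ D := by positivity
  -- `B > 0` (else `A ≤ D s^{−d}` for all `s`, impossible for large `s`)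
  have hBpos : 0 < B := by
    rcases hB0.eq_or_lt with hB00 | hB00
    · exfalso
      rcases hD0.eq_or_lt with hD00 | hD00
      · have h1 := h 1 one_pos
        rw [← hB00, ← hD00, mul_zero, zero_mul, add_zero] at h1
        linarith
      · -- `s = ((D + A)/A)^{1/d}`: `D s^{−d} = DA/(D+A) < A`
        set s := ((D + A) / A) ^ (1 / d) with hs
        have hq : 0 < (D + A) / A := by positivity
        have hs0 : 0 < s := Real.rpow_pos_of_pos hq _
        have hsd : s ^ (-d) = A / (D + A) := by
          rw [hs, ← Real.rpow_mul hq.le, show 1 / d * -d = -1 by field_simp, Real.rpow_neg_one, inv_div]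
        have h1 := h s hs0
        rw [← hB00, mul_zero, zero_add, hsd, ← mul_div_assoc, le_div_iff₀ (by positivity)] at h1
        nlinarith
    · exact hB00
  -- `D > 0` (else `A ≤ sB` for all `s`, impossible for small `s`)
  have hDpos : 0 < D := by
    rcases hD0.eq_or_lt with hD00 | hD00
    · exfalso
      have h1 := h (A / (2 * B)) (by positivity)
      rw [← hD00, zero_mul, add_zero, show A / (2 * B) * B = A / 2 by field_simp] at h1
      linarith
    · exact hD00
  have hL0 : 0 < L := by
    rcases hL.eq_or_lt with h0 | h0
    · exfalso; rw [hD, ← h0] at hDpos; simp at hDpos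
    · exact h0
  have hBne : B ≠ 0 := hBpos.ne'
  have hDne : D ≠ 0 := hDpos.ne'
  have hdne : d ≠ 0 := hd0.ne'
  -- the minimiser `s = (dD/B)^{1/(d+1)}`: `s^{d+1} = dD/B`, `D s^{−d} = sB/d`
  set s := (d * D / B) ^ (1 / (d + 1)) with hs
  have hq : 0 < d * D / B := by positivity
  have hs0 : 0 < s := Real.rpow_pos_of_pos hq _
  have hsd1 : s ^ (d + 1) = d * D / B := by
    rw [hs, ← Real.rpow_mul hq.le, show 1 / (d + 1) * (d + 1) = 1 by field_simp, Real.rpow_one]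
  have hDs : D * s ^ (-d) = s * B / d := by
    have e1 : s ^ (-d) = s * (s ^ (d + 1))⁻¹ := by
      rw [show -d = 1 + -(d + 1) by ring, Real.rpow_add hs0, Real.rpow_one, Real.rpow_neg hs0.le]
    rw [e1, hsd1]
    field_simp
  have hkey : A * (d / (d + 1)) ≤ s * B := by
    have h' := h s hs0
    rw [hDs] at h'
    have h'' : A * d ≤ s * B * (d + 1) :=
      calc A * d ≤ (s * B + s * B / d) * d := mul_le_mul_of_nonneg_right h' hd0.le
        _ = s * B * (d + 1) := by rw [add_mul, div_mul_cancel₀ _ hdne]; ring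
    rw [mul_div_assoc', div_le_iff₀ (by linarith : (0:ℝ) < d + 1)]
    exact h''
  -- raise to the power `d + 1`: `(A d/(d+1))^{d+1} ≤ s^{d+1}B^{d+1} = dD·B^d = dD(aG)^{d/2}A^{d/2}`
  have hu0 : 0 ≤ A * (d / (d + 1)) := by positivity
  have h1 : (A * (d / (d + 1))) ^ (d + 1) ≤ d * D * ((a * G) ^ (d / 2) * A ^ (d / 2)) := by
    have h' := Real.rpow_le_rpow hu0 hkey (by linarith : (0:ℝ) ≤ d + 1)
    rw [Real.mul_rpow hs0.le hB0, hsd1] at h'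
    have eB : B ^ (d + 1) = B * B ^ d := by rw [Real.rpow_add hBpos, Real.rpow_one, mul_comm]
    have eBd : B ^ d = (a * G) ^ (d / 2) * A ^ (d / 2) := by
      rw [hB, Real.sqrt_eq_rpow, ← Real.rpow_mul (by positivity), show (1:ℝ) / 2 * d = d / 2 by ring,
        Real.mul_rpow (by positivity) hA]
    rw [eB, eBd] at h'
    have e : d * D / B * (B * ((a * G) ^ (d / 2) * A ^ (d / 2))) =
        d * D * ((a * G) ^ (d / 2) * A ^ (d / 2)) * (B / B) := by ring
    rwa [e, div_self hBne, mul_one] at h'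
  -- cancel `A^{d/2}`: `A^{1+d/2} (d/(d+1))^{d+1} ≤ dD(aG)^{d/2}`
  have hAd2 : 0 < A ^ (d / 2) := Real.rpow_pos_of_pos hA0 _
  have eA : A ^ (d + 1) = A ^ (1 + d / 2) * A ^ (d / 2) := by
    rw [← Real.rpow_add hA0]; congr 1; ring
  have h2 : A ^ (1 + d / 2) * (d / (d + 1)) ^ (d + 1) ≤ d * D * (a * G) ^ (d / 2) := by
    rw [Real.mul_rpow hA (by positivity), eA] at h1
    have h1' : A ^ (1 + d / 2) * (d / (d + 1)) ^ (d + 1) * A ^ (d / 2) ≤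
        d * D * (a * G) ^ (d / 2) * A ^ (d / 2) :=
      calc _ = A ^ (1 + d / 2) * A ^ (d / 2) * (d / (d + 1)) ^ (d + 1) := by ring
        _ ≤ d * D * ((a * G) ^ (d / 2) * A ^ (d / 2)) := h1
        _ = _ := by ring
    exact le_of_mul_le_mul_right h1' hAd2
  -- divide by `(d/(d+1))^{d+1}` and raise to the power `2/d`
  have hcpos : 0 < d / (d + 1) := by positivity
  have hc0 : 0 < (d / (d + 1)) ^ (d + 1) := Real.rpow_pos_of_pos hcpos _
  have h3 : A ^ (1 + d / 2) ≤ ((d + 1) / d) ^ (d + 1) * (d * D * (a * G) ^ (d / 2)) := by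
    rw [← le_div_iff₀ hc0] at h2
    refine h2.trans (le_of_eq ?_)
    rw [div_eq_mul_inv, ← Real.inv_rpow hcpos.le, inv_div, mul_comm]
  have hA12 : 0 ≤ A ^ (1 + d / 2) := Real.rpow_nonneg hA _
  have h4 := Real.rpow_le_rpow hA12 h3 (by positivity : (0:ℝ) ≤ 2 / d)
  rw [← Real.rpow_mul hA, show (1 + d / 2) * (2 / d) = 1 + 2 / d by field_simp; ring] at h4
  refine h4.trans (le_of_eq ?_)
  -- the routine simplification of the constant
  have hdd : 0 < (d + 1) / d := by positivity
  have e1 : (((d + 1) / d) ^ (d + 1) * (d * D * (a * G) ^ (d / 2))) ^ (2 / d) =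
      (((d + 1) / d) ^ (d + 1)) ^ (2 / d) * (d ^ (2 / d) * D ^ (2 / d) * ((a * G) ^ (d / 2)) ^ (2 / d)) := by
    rw [Real.mul_rpow (by positivity) (by positivity), Real.mul_rpow (by positivity) (by positivity),
      Real.mul_rpow (by positivity) (by positivity)]
  have hdd' : 0 < 1 + 1 / d := by positivity
  have e2 : (((d + 1) / d) ^ (d + 1)) ^ (2 / d) = (1 + 1 / d) ^ 2 * (1 + 1 / d) ^ (2 / d) := by
    rw [show (d + 1) / d = 1 + 1 / d by rw [add_div, div_self hdne], ← Real.rpow_mul hdd'.le,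
      show (d + 1) * (2 / d) = 2 + 2 / d by field_simp, Real.rpow_add hdd', Real.rpow_two]
  have e3 : ((a * G) ^ (d / 2)) ^ (2 / d) = a * G := by
    rw [← Real.rpow_mul (by positivity), show d / 2 * (2 / d) = 1 by field_simp, Real.rpow_one]
  have e4 : D ^ (2 / d) = M ^ (2 / d) * L ^ (4 / d) := by
    rw [hD, Real.mul_rpow hM.le (sq_nonneg L), ← Real.rpow_two, ← Real.rpow_mul hL,
      show (2:ℝ) * (2 / d) = 4 / d by ring]
  have e5 : (1 + 1 / d) ^ (2 / d) * d ^ (2 / d) = (1 + d) ^ (2 / d) := by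
    rw [← Real.mul_rpow (by positivity) hd0.le, add_mul, one_mul, div_mul_cancel₀ _ hdne, add_comm]
  rw [e1, e2, e3, e4, ← e5]
  ring

end Minimisation

/-! ## THEOREM 5.2 -/

section TheoremFiveTwo

/-- **THEOREM 5.2 (Diaconis–Saloff-Coste 1996), abstract averages (REMARK 5.4 (2)).**  Let `π > 0`
on the finite set `X`, `f : X → ℝ`, `E ≥ 0` (the value `𝓔(f,f)` of a Dirichlet form), reals `M > 0`,
`d ≥ 1`, `a > 0`, an integer `R ≥ 1`, and for each integer `r ∈ [0,R]` a function `f_r` with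
`‖f_r‖_∞ ≤ M(r+1)^{−d}‖f‖₁` and `‖f − f_r‖₂² ≤ a r² E`.  Then **`‖f‖₂^{2(1+2/d)} ≤ C[E +
(aR²)⁻¹‖f‖₂²]‖f‖₁^{4/d}`, `C = (1 + 1/d)²(1 + d)^{2/d}M^{2/d}a`**.  Proof as printed: `‖f‖₂² =
⟨f − f_r, f⟩ + ⟨f_r, f⟩ ≤ a^{1/2}r𝓔^{1/2}‖f‖₂ + M(r+1)^{−d}‖f‖₁²` for integers `r ≤ R`, the same with
`𝓔 + (aR²)⁻¹‖f‖₂²` for all integers `r ≥ 0`, hence for all reals `s > 0`, then minimise in `s`.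
[cite: DiaconisSaloffcoste1996Nash, §5.3 Theorem 5.2 and Remark 5.4 (2)] -/
theorem DiaconisSaloffcoste1996_thm_5_2 (hπ : ∀ y, 0 < π y) {f : X → ℝ} {E a M d : ℝ} {R : ℕ}
    (hE : 0 ≤ E) (ha : 0 < a) (hM : 0 < M) (hd : 1 ≤ d) (hR : 1 ≤ R) (avg : ℕ → X → ℝ)
    (hsup : ∀ r : ℕ, r ≤ R → ∀ x, |avg r x| ≤ M * ((r : ℝ) + 1) ^ (-d) * ∑ y, π y * |f y|)
    (hloc : ∀ r : ℕ, r ≤ R →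
      piInner π (fun x => f x - avg r x) (fun x => f x - avg r x) ≤ a * (r : ℝ) ^ 2 * E) :
    piInner π f f ^ (1 + 2 / d) ≤ (1 + 1 / d) ^ 2 * (1 + d) ^ (2 / d) * M ^ (2 / d) * a *
      (E + (a * (R : ℝ) ^ 2)⁻¹ * piInner π f f) * (∑ y, π y * |f y|) ^ (4 / d) := by
  have hπ0 : ∀ y, 0 ≤ π y := fun y => (hπ y).le
  have hd0 : 0 < d := by linarith
  set A := piInner π f f with hAdef
  set L := ∑ y, π y * |f y| with hLdef
  set G := E + (a * (R : ℝ) ^ 2)⁻¹ * A with hGdef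
  have hA : 0 ≤ A := piInner_self_nonneg hπ0 f
  have hL : 0 ≤ L := sum_nonneg fun y _ => mul_nonneg (hπ0 y) (abs_nonneg _)
  have hR0 : 0 < (R : ℝ) := by exact_mod_cast hR
  have hG : 0 ≤ G := by positivity
  have hEG : E ≤ G := by
    have h0 : 0 ≤ (a * (R : ℝ) ^ 2)⁻¹ * A := by positivity
    linarith
  -- Step 1: the two-term bound for every integer `r`
  have hint : ∀ r : ℕ, A ≤ r * Real.sqrt (a * G * A) + M * L ^ 2 * ((r : ℝ) + 1) ^ (-d) := by
    intro r
    have hr1 : 0 < (r : ℝ) + 1 := by positivity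
    have hsecond0 : 0 ≤ M * L ^ 2 * ((r : ℝ) + 1) ^ (-d) := by positivity
    by_cases hr : r ≤ R
    · -- `A = ⟨f − f_r, f⟩ + ⟨f_r, f⟩`
      have hsplit : A = piInner π (fun x => f x - avg r x) f + piInner π (avg r) f := by
        simp only [hAdef, piInner, ← sum_add_distrib]; exact sum_congr rfl fun x _ => by ring
      -- `⟨f − f_r, f⟩ ≤ ‖f − f_r‖₂‖f‖₂ ≤ r (aGA)^{1/2}`
      have h1 : piInner π (fun x => f x - avg r x) f ≤ r * Real.sqrt (a * G * A) := by
        have hcs := piInner_sq_le_mul hπ0 (fun x => f x - avg r x) f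
        have hb : piInner π (fun x => f x - avg r x) (fun x => f x - avg r x) * A ≤
            ((r : ℝ) * Real.sqrt (a * G * A)) ^ 2 := by
          rw [mul_pow, Real.sq_sqrt (by positivity)]
          calc _ ≤ a * (r : ℝ) ^ 2 * E * A := mul_le_mul_of_nonneg_right (hloc r hr) hA
            _ ≤ a * (r : ℝ) ^ 2 * G * A := by gcongr
            _ = (r : ℝ) ^ 2 * (a * G * A) := by ring
        exact abs_le_of_sq_le_sq' (hcs.trans hb) (by positivity) |>.2
      -- `⟨f_r, f⟩ ≤ ‖f_r‖_∞‖f‖₁ ≤ M(r+1)^{−d}‖f‖₁²`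
      have h2 : piInner π (avg r) f ≤ M * L ^ 2 * ((r : ℝ) + 1) ^ (-d) := by
        calc piInner π (avg r) f = ∑ x, π x * (avg r x * f x) := rfl
          _ ≤ ∑ x, (M * ((r : ℝ) + 1) ^ (-d) * L) * (π x * |f x|) := sum_le_sum fun x _ => by
              have hx := mul_le_mul_of_nonneg_right (hsup r hr x) (abs_nonneg (f x))
              calc π x * (avg r x * f x) ≤ π x * (|avg r x| * |f x|) :=
                    mul_le_mul_of_nonneg_left (by rw [← abs_mul]; exact le_abs_self _) (hπ0 x)
                _ ≤ π x * (M * ((r : ℝ) + 1) ^ (-d) * L * |f x|) := mul_le_mul_of_nonneg_left hx (hπ0 x)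
                _ = _ := by ring
          _ = (M * ((r : ℝ) + 1) ^ (-d) * L) * ∑ x, π x * |f x| := by rw [← Finset.mul_sum]
          _ = M * L ^ 2 * ((r : ℝ) + 1) ^ (-d) := by rw [← hLdef]; ring
      linarith [hsplit, h1, h2]
    · -- `r > R`: `r(aGA)^{1/2} ≥ (r/R)A ≥ A`
      have hrR : (R : ℝ) + 1 ≤ r := by exact_mod_cast Nat.lt_of_not_le hr
      have hsq : A / R ≤ Real.sqrt (a * G * A) := by
        refine (le_abs_self _).trans (Real.abs_le_sqrt ?_)
        have : a * ((a * (R : ℝ) ^ 2)⁻¹ * A) * A ≤ a * G * A := by gcongr; linarith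
        calc (A / R) ^ 2 = a * ((a * (R : ℝ) ^ 2)⁻¹ * A) * A := by field_simp
          _ ≤ a * G * A := this
      have : A ≤ r * Real.sqrt (a * G * A) :=
        calc A ≤ (r : ℝ) * (A / R) := by
              rw [mul_div_assoc', le_div_iff₀ hR0]; nlinarith
          _ ≤ r * Real.sqrt (a * G * A) := mul_le_mul_of_nonneg_left hsq (by positivity)
      linarith
  -- Step 2: for all reals `s > 0` (take `r = ⌊s⌋`: `r ≤ s < r + 1`)
  have hreal : ∀ s : ℝ, 0 < s → A ≤ s * Real.sqrt (a * G * A) + M * L ^ 2 * s ^ (-d) := by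
    intro s hs
    have h := hint ⌊s⌋₊
    have hfl : (⌊s⌋₊ : ℝ) ≤ s := Nat.floor_le hs.le
    have hfl1 : s ≤ (⌊s⌋₊ : ℝ) + 1 := (Nat.lt_floor_add_one s).le
    have hpow : ((⌊s⌋₊ : ℝ) + 1) ^ (-d) ≤ s ^ (-d) := by
      rw [Real.rpow_neg hs.le, Real.rpow_neg (by positivity)]
      exact inv_anti₀ (Real.rpow_pos_of_pos hs d) (Real.rpow_le_rpow hs.le hfl1 hd0.le)
    have hB0 : 0 ≤ Real.sqrt (a * G * A) := Real.sqrt_nonneg _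
    nlinarith [mul_le_mul_of_nonneg_right hfl hB0, mul_le_mul_of_nonneg_left hpow (by positivity : 0 ≤ M * L ^ 2)]
  -- Step 3: minimise
  exact nash_of_two_term_bound hA hL hG ha hM hd hreal

/-- **THEOREM 5.2 (Diaconis–Saloff-Coste 1996) for averages over any family of sets**
`B(x,r)` with the volume bound `V(x,r) = π(B(x,r)) ≥ (r+1)^d/M` (`r ≤ R`) and the local Poincaré
inequality `‖f − f_r‖₂² ≤ a r²E` (`r ≤ R`): the Nash inequality with `C = (1+1/d)²(1+d)^{2/d}M^{2/d}a`
and `T = aR²`. [cite: DiaconisSaloffcoste1996Nash, §5.3 Theorem 5.2, Remark 5.4 (2)] -/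
theorem DiaconisSaloffcoste1996_thm_5_2_sets (hπ : ∀ y, 0 < π y) {B : X → ℕ → Finset X}
    {f : X → ℝ} {E a M d : ℝ} {R : ℕ} (hE : 0 ≤ E) (ha : 0 < a) (hM : 0 < M) (hd : 1 ≤ d)
    (hR : 1 ≤ R) (hV : ∀ r : ℕ, r ≤ R → ∀ x, ((r : ℝ) + 1) ^ d / M ≤ ∑ y ∈ B x r, π y)
    (hloc : ∀ r : ℕ, r ≤ R → piInner π (fun x => f x - setAverage π B r f x)
      (fun x => f x - setAverage π B r f x) ≤ a * (r : ℝ) ^ 2 * E) :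
    piInner π f f ^ (1 + 2 / d) ≤ (1 + 1 / d) ^ 2 * (1 + d) ^ (2 / d) * M ^ (2 / d) * a *
      (E + (a * (R : ℝ) ^ 2)⁻¹ * piInner π f f) * (∑ y, π y * |f y|) ^ (4 / d) :=
  DiaconisSaloffcoste1996_thm_5_2 hπ hE ha hM hd hR (fun r => setAverage π B r f)
    (fun r hr x => abs_setAverage_le (fun y => (hπ y).le) hM (hV r hr x) f) hloc

end TheoremFiveTwo

/-! ## Saloff-Coste's normalisation: THEOREM 3.4.3 (first display) -/

section ModerateGrowth

variable {P : Matrix X X ℝ}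

/-- **THEOREM 3.4.3 (Saloff-Coste 1997), the Nash inequality.**  Let `(K,π)` be a finite chain with
`π > 0`, `γ ≥ 1` an integer (the diameter of an adapted edge set in the source), `B(x,r)` a family
of sets ("balls") with **(M,d)-moderate growth `V(x,r) ≥ M⁻¹((r+1)/γ)^d`** and the **local Poincaré
inequality `‖f − f_r‖₂² ≤ a r²𝓔(f,f)`** for all integers `r ≤ γ` (DEFINITION 3.4.1).  Then
**`‖f‖₂^{2(1+2/d)} ≤ C[𝓔(f,f) + (aγ²)⁻¹‖f‖₂²]‖f‖₁^{4/d}` with `C = (1+1/d)²(1+d)^{2/d}M^{2/d}aγ²`**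
(DSC THEOREM 5.2 with `M ↦ Mγ^d`, `R = γ`). [cite: Saloffcoste1997, §3.4 Definition 3.4.1 and
Theorem 3.4.3 (first display); DiaconisSaloffcoste1996Nash, §5.3 proof of Theorem 5.1] -/
theorem Saloffcoste1997_thm_3_4_3_nash (hπ : ∀ y, 0 < π y) {B : X → ℕ → Finset X} {a M d : ℝ}
    {γ : ℕ} (ha : 0 < a) (hM : 0 < M) (hd : 1 ≤ d) (hγ : 1 ≤ γ) (hP0 : ∀ x y, 0 ≤ P x y)
    (hV : ∀ r : ℕ, r ≤ γ → ∀ x, M⁻¹ * (((r : ℝ) + 1) / γ) ^ d ≤ ∑ y ∈ B x r, π y)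
    (hloc : ∀ r : ℕ, r ≤ γ → ∀ f : X → ℝ, piInner π (fun x => f x - setAverage π B r f x)
      (fun x => f x - setAverage π B r f x) ≤ a * (r : ℝ) ^ 2 * dirichletForm π P f)
    (f : X → ℝ) :
    piInner π f f ^ (1 + 2 / d) ≤ (1 + 1 / d) ^ 2 * (1 + d) ^ (2 / d) * M ^ (2 / d) * a * (γ : ℝ) ^ 2 *
      (dirichletForm π P f + (a * (γ : ℝ) ^ 2)⁻¹ * piInner π f f) * (∑ y, π y * |f y|) ^ (4 / d) := by
  have hγ0 : 0 < (γ : ℝ) := by exact_mod_cast hγ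
  have hd0 : 0 < d := by linarith
  have hMγ : 0 < M * (γ : ℝ) ^ d := mul_pos hM (Real.rpow_pos_of_pos hγ0 d)
  -- the volume bound in DSC's normalisation `V(x,r) ≥ (r+1)^d/(Mγ^d)`
  have hV' : ∀ r : ℕ, r ≤ γ → ∀ x, ((r : ℝ) + 1) ^ d / (M * (γ : ℝ) ^ d) ≤ ∑ y ∈ B x r, π y := by
    intro r hr x
    refine le_trans (le_of_eq ?_) (hV r hr x)
    rw [Real.div_rpow (by positivity) hγ0.le]; field_simp
  have h := DiaconisSaloffcoste1996_thm_5_2_sets hπ (dirichletForm_nonneg (fun y => (hπ y).le) hP0 f)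
    ha hMγ hd hγ hV' (hloc · · f)
  -- `(Mγ^d)^{2/d} = M^{2/d}γ²`
  rw [Real.mul_rpow hM.le (Real.rpow_nonneg hγ0.le _), ← Real.rpow_mul hγ0.le,
    show d * (2 / d) = 2 by field_simp, show (γ : ℝ) ^ (2:ℝ) = (γ : ℝ) ^ 2 by norm_cast] at h
  simpa [mul_assoc, mul_comm, mul_left_comm] using h

end ModerateGrowth

end Literature.Probability.MarkovChains
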